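import Summits.AtomisticToContinuum.Crystallization.Theorems.FrustratedLawDichotomyCollarCensusMilli

/-!
# FrustratedLawDichotomy · crux `AperiodicFrustratedLawGap` (stmt-AtomisticToContinuum-27623) — the collared node GENERIC IN THE RANGE DATA
# `(w, ω, A, R, B, R′, eUp)` as well as in both levies (decomp-a2c, prover hand 2, generation 17)

Why: hand-1 g15's pricing-side memo (HAND1-G15.md §(iii)) measures the E-side margin of `Eopt♭` at range `9/2` as `×1.7–2.7` FOR EVERY `κ_E > 0`
(the Schur-floor slack `1.15·10⁻³` plus `eUp − e⋆` eat the room) and names a LONGER RANGE (`R′ = 6`: slack `2.8·10⁻⁴`, margin `×4–8`) as the cheapest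
structural lever should an E-adversary appear.  The κ re-file of today (`…CollarCensusMilli`) was an instantiation only because the column had been
typed κ-generically the day before; this file does the same for the RANGE: every range-specific input of the collared node — the Schur floor `SF₄₅`, the
cut bounds `W₄₅_cutBounds`, the vanishing radius `effPot_fourHalf_eq_zero`, the ceiling literal `−0.7175` — becomes a hypothesis/parameter, so that a
range-`R′` re-file is: prove `SchurFloor w ω A` (hand-1's bump certificate at the new range), `CutBounds (effPot w ω A) R B`, `effPot w ω A = 0` on
`[R′, ∞)`, `PeriodicEnergyCeiling eUp`, and instantiate.

* §1 ★★ `aperiodicFrustratedLawGap_of_collarMotifCapKK_generic` — census-object form: `MuEquilibriumDoor ∧ SchurFloor w ω A ∧ UP(eUp) ∧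
  SchurElasticPricingX (1/20)(1/8) w ω A eUp κ_E C_E D_E D_X (LocOptFails e⋆ ε ϱ′ 1) ∧ EquilibriumMotifPricingCapK κ_T ρ ϱ D W (eUp + A) (CollarCore r eUp ε Rm s t)
  ⟹ AperiodicFrustratedLawGap` (`W = effPot w ω A` cut at `R′ ≤ ρ₁ + r`, `CutBounds W R B`, `0 < κ_T ≤ 1`, `0 < κ_E`);
* §2 ★ `…_of_collarPiecesKK_generic` — the three pieces at the record GEOMETRY literals `(ρ, D, r, ρ₁, ϱ, ε, Rm, s, t, ϱ′) =
  (9/5, 3/2, 9/2, 7, 133/10, 10⁻⁴, 7, 1/20, 10⁻⁴, 3/2)` for any range data with `R′ ≤ 23/2` (so `R′ = 5, 6, 7, …` all fit the record motif radius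
  `ϱ = 133/10`);
* §3 sanity (`example`): the range-`9/2` record data recover `…CollarCensusMilli.aperiodicFrustratedLawGap_of_collarPiecesKK_milli`.
All `[folklore]` chaining; 0 sorry; no definitions.
-/

noncomputable section

namespace Summit.AtomisticToContinuum.Crystallization.Theorems.FrustratedLawDichotomyCollarCensusGeneric

open scoped BigOperators Classical
open Summit.AtomisticToContinuum.Crystallization.Theorems.ChargedEnergyGapNegative (E3 eStar)
open Summit.AtomisticToContinuum.Crystallization.Theorems.FrustratedLawDichotomyRangeCut
open Summit.AtomisticToContinuum.Crystallization.Theorems.FrustratedLawDichotomySchurCut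
open Summit.AtomisticToContinuum.Crystallization.Theorems.FrustratedLawDichotomyAveragingCut
  (Mball one_le_Mball Dfl Dfl_pos CT₀ Dfl_le_CT₀ CT₄₅ W₄₅_cutBounds CutBounds)
open Summit.AtomisticToContinuum.Crystallization.Theorems.FrustratedLawDichotomyAveragingRule
open Summit.AtomisticToContinuum.Crystallization.Theorems.FrustratedLawDichotomyAveragingRuleCap
open Summit.AtomisticToContinuum.Crystallization.Theorems.FrustratedLawDichotomyExemptDoor (SitePred)
open Summit.AtomisticToContinuum.Crystallization.Theorems.FrustratedLawDichotomyExemptLocOpt (LocOptFails deepAbsent_locOptFails)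
open Summit.AtomisticToContinuum.Crystallization.Theorems.FrustratedLawDichotomyExemptSplit
  (SchurTopologicalPricingX SchurElasticPricingX aperiodicFrustratedLawGap_of_splitX)
open Summit.AtomisticToContinuum.Crystallization.Theorems.FrustratedLawDichotomyExemptAbsorption
open Summit.AtomisticToContinuum.Crystallization.Theorems.FrustratedLawDichotomyExemptAbsorptionRecord
open Summit.AtomisticToContinuum.Crystallization.Theorems.FrustratedLawDichotomyCollarCensus
open Summit.AtomisticToContinuum.Crystallization.Theorems.FrustratedLawDichotomyCollarCensusKappa
open Summit.AtomisticToContinuum.Crystallization.Theorems.FrustratedLawDichotomyCollarCensusMilli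

/-! ## §1. The collared node for general range data -/

/-- ★★ **THE COLLARED NODE, GENERIC IN THE RANGE DATA AND BOTH LEVIES** (census-object form).  Range data: a Schur-admissible split
`(w, ω, A)` (`hF : SchurFloor w ω A`), its effective potential `W = effPot w ω A` with cut bounds `CutBounds W R B` and vanishing radius `R′`
(`W = 0` on `[R′, ∞)`), a periodic energy ceiling `UP(eUp)`; levies `0 < κ_T ≤ 1`, `0 < κ_E`; geometry side conditions as in
`…CollarCensusKappa.aperiodicFrustratedLawGap_of_collarMotifCapKK` with `9/2` replaced by `R′`.  Then
`MuEquilibriumDoor ∧ Eopt-raw(κ_E; LocOptFails e⋆ ε ϱ′ 1) ∧ EquilibriumMotifPricingCapK κ_T ρ ϱ D W (eUp + A) (CollarCore r eUp ε Rm s t) ⟹ AperiodicFrustratedLawGap`.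
[folklore chaining] -/
theorem aperiodicFrustratedLawGap_of_collarMotifCapKK_generic {w ω : ℝ → ℝ} {A R B R' eUp κT κE ρ r ρ₁ ϱ D ε Rm s t ϱ' CE DE DX : ℝ}
    (hDoor : Summit.AtomisticToContinuum.Crystallization.Theses.GrainCoreNetworkSplit.MuEquilibriumDoor)
    (hF : SchurFloor w ω A) (hWB : CutBounds (effPot w ω A) R B) (hW : ∀ u, R' ≤ u → effPot w ω A u = 0)
    (hU : PeriodicEnergyCeiling eUp) (hε : 0 < ε) (hDX : 0 ≤ DX) (hκE : 0 < κE)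
    (hE : SchurElasticPricingX (1 / 20) (1 / 8) w ω A eUp κE CE DE DX (LocOptFails eStar ε ϱ' 1))
    (hκ0 : 0 < κT) (hκ1 : κT ≤ 1) (h0 : 0 ≤ ρ) (hr : 0 ≤ r) (h1 : 0 ≤ ρ₁) (hρ : ρ ≤ ρ₁ + r) (hR : R' ≤ ρ₁ + r)
    (hD : 13 / 10 * D + 1 ≤ ρ₁ + r) (hRm : Rm ≤ ρ₁) (hϱ : ρ + (ρ₁ + r) ≤ ϱ) (hRm1 : 1 + s ≤ Rm) (hs0 : 0 ≤ s) (hs : s ≤ ϱ') (hεt : ε ≤ t)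
    (h : EquilibriumMotifPricingCapK κT ρ ϱ D (effPot w ω A) (eUp + A) (CollarCore r eUp ε Rm s t)) :
    Summit.AtomisticToContinuum.Crystallization.Theses.FrustratedLawDichotomy.AperiodicFrustratedLawGap := by
  have hC : 0 ≤ CT₀ R B (eUp + A) ρ :=
    (Dfl_pos hWB.range_nonneg hWB.floor_nonneg).le.trans (Dfl_le_CT₀ hWB.range_nonneg hWB.floor_nonneg ρ)
  have hM : 0 ≤ Mball r * CT₀ R B (eUp + A) ρ := mul_nonneg (zero_le_one.trans (one_le_Mball hr)) hC
  have hUp : eStar ≤ eUp := eStar_le_of_periodicEnergyCeiling hU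
  have hT : SchurTopologicalPricingX (1 / 20) (1 / 8) w ω A eUp κT (CT₀ R B (eUp + A) ρ) (Mball r * CT₀ R B (eUp + A) ρ)
      (LocOptFails eStar ε ϱ' 1) := by
    unfold CollarCore at h
    exact schurTopologicalPricingX_of_collarMotifCapK hWB hW h0 hr h1 hρ hR hD hϱ (flag_nonEquilibriumCore_isLocal hRm) hκ0.le hκ1
      (fun _ _ _ hsep _ hx => locOptFails_of_nonEquilibriumCore hUp hRm1 hs0 hs hεt hsep hx) h
  exact aperiodicFrustratedLawGap_of_splitX hDoor (by norm_num) hF hU (deepAbsent_locOptFails hε) hκ0 hM hT hκE hDX hE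

/-! ## §2. The three pieces at the record geometry, generic range data -/

/-- ★ **THE NODE IN THREE PIECES, GENERIC RANGE DATA, RECORD GEOMETRY** (`R′ ≤ 23/2`; `(ρ, D, r, ρ₁, ϱ, ε, Rm, s, t, ϱ′) =
(9/5, 3/2, 9/2, 7, 133/10, 10⁻⁴, 7, 1/20, 10⁻⁴, 3/2)`):
`MuEquilibriumDoor ∧ SchurFloor w ω A ∧ UP(eUp) ∧ Eopt-raw(κ_E) ∧ F1^X(κ_T; W, eUp) ∧ CC(κ_T; W, eUp) ∧ DD(κ_T; W, eUp) ⟹ AperiodicFrustratedLawGap`.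
A range-`R′` re-file of the leaf line is this theorem applied to `(w_R′, ω_R′, A_R′)` data. [folklore chaining] -/
theorem aperiodicFrustratedLawGap_of_collarPiecesKK_generic {w ω : ℝ → ℝ} {A R B R' eUp κT κE CE DE DX : ℝ}
    (hDoor : Summit.AtomisticToContinuum.Crystallization.Theses.GrainCoreNetworkSplit.MuEquilibriumDoor)
    (hF : SchurFloor w ω A) (hWB : CutBounds (effPot w ω A) R B) (hW : ∀ u, R' ≤ u → effPot w ω A u = 0) (hR' : R' ≤ 23 / 2)
    (hU : PeriodicEnergyCeiling eUp) (hDX : 0 ≤ DX) (hκE : 0 < κE)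
    (hE : SchurElasticPricingX (1 / 20) (1 / 8) w ω A eUp κE CE DE DX (LocOptFails eStar (1 / 10000) (3 / 2) 1))
    (hκ0 : 0 < κT) (hκ1 : κT ≤ 1)
    (h1 : StrainedPatchMotifPricingCapXK κT (9 / 5) (133 / 10) (3 / 2) (effPot w ω A) (eUp + A)
      (CollarCore (9 / 2) eUp (1 / 10000) 7 (1 / 20) (1 / 10000)))
    (h2 : CrowdedCoreMotifPricingCapK κT (9 / 5) (133 / 10) (3 / 2) (effPot w ω A) (eUp + A)
      (CollarCore (9 / 2) eUp (1 / 10000) 7 (1 / 20) (1 / 10000)))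
    (h3 : DiluteDefectMotifPricingCapK κT (9 / 5) (133 / 10) (3 / 2) (effPot w ω A) (eUp + A)
      (CollarCore (9 / 2) eUp (1 / 10000) 7 (1 / 20) (1 / 10000))) :
    Summit.AtomisticToContinuum.Crystallization.Theses.FrustratedLawDichotomy.AperiodicFrustratedLawGap :=
  aperiodicFrustratedLawGap_of_collarMotifCapKK_generic (ρ₁ := 7) hDoor hF hWB hW hU (by norm_num) hDX hκE hE hκ0 hκ1 (by norm_num) (by norm_num)
    (by norm_num) (by norm_num) (by linarith) (by norm_num) le_rfl (by norm_num) (by norm_num) (by norm_num) (by norm_num) le_rfl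
    (equilibriumMotifPricingCapK_iff_pieces.2 ⟨h1, h2, h3⟩)

/-! ## §3. Sanity: the range-`9/2` record data give back the milli node -/

/-- At the record range data `(w₄₅, ω₄, 3/400; R′ = 9/2; eUp = −0.7175)`, `SF₄₅` from `sf₄₅_holds` and the levies of record, the generic node IS the
milli leaf line `…CollarCensusMilli.aperiodicFrustratedLawGap_of_collarPiecesKK_milli` (same hypotheses, same conclusion; an `example`, since the
statement is literally the landed one — dedup). [folklore] -/
example {CE DE DX : ℝ}
    (hDoor : Summit.AtomisticToContinuum.Crystallization.Theses.GrainCoreNetworkSplit.MuEquilibriumDoor)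
    (hU : PeriodicEnergyCeiling (-(7175 / 10000))) (hDX : 0 ≤ DX)
    (hE : SchurElasticPricingX (1 / 20) (1 / 8) w₄₅ ω₄ (3 / 400) (-(7175 / 10000)) (1 / 10000) CE DE DX
      (LocOptFails eStar (1 / 10000) (3 / 2) 1))
    (h1 : StrainedPatchMotifPricingCapXK (1 / 1000) (9 / 5) (133 / 10) (3 / 2) (effPot w₄₅ ω₄ (3 / 400)) (-(7175 / 10000) + 3 / 400)
      (CollarCore (9 / 2) (-(7175 / 10000)) (1 / 10000) 7 (1 / 20) (1 / 10000)))
    (h2 : CrowdedCoreMotifPricingCapK (1 / 1000) (9 / 5) (133 / 10) (3 / 2) (effPot w₄₅ ω₄ (3 / 400)) (-(7175 / 10000) + 3 / 400)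
      (CollarCore (9 / 2) (-(7175 / 10000)) (1 / 10000) 7 (1 / 20) (1 / 10000)))
    (h3 : DiluteDefectMotifPricingCapK (1 / 1000) (9 / 5) (133 / 10) (3 / 2) (effPot w₄₅ ω₄ (3 / 400)) (-(7175 / 10000) + 3 / 400)
      (CollarCore (9 / 2) (-(7175 / 10000)) (1 / 10000) 7 (1 / 20) (1 / 10000))) :
    Summit.AtomisticToContinuum.Crystallization.Theses.FrustratedLawDichotomy.AperiodicFrustratedLawGap :=
  aperiodicFrustratedLawGap_of_collarPiecesKK_generic hDoor
    Summit.AtomisticToContinuum.Crystallization.Theorems.FrustratedLawDichotomyBumpAutocorrelation.sf₄₅_holds W₄₅_cutBounds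
    (fun _ hu => effPot_fourHalf_eq_zero _ hu) (by norm_num) hU hDX (by norm_num) hE (by norm_num) (by norm_num) h1 h2 h3

end Summit.AtomisticToContinuum.Crystallization.Theorems.FrustratedLawDichotomyCollarCensusGeneric

end
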